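import Mathlib
import HarnessLib
import Summits.HubbardSuperconductivity.HubbardSuperconductivity.Theorems.KLProgrammeH10TwoPointLimitPerturbedCountPairs

/-!
# Route `KLProgramme` — K3 engine child `KLRegimeEngineV17F2` (stmt-HubbardSuperconductivity-20437), stub (b) import ι₂:
# the SMALL CONSTANTS of the thin anchored count on the perturbed curve

Cell gate-hubbard-kl, plan g17 (R41)(i) «E1-P2-THIN-COUNT» (seat p4; assembly, part 3).  The thin pair count `count_pairs_thin_perturbed_exists`
carries some twenty smallness conditions in the named perturbed constants `pc*` (covering, Cooper, fold, stratum, near-critical thresholds,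
class-(C) gap, alignment dichotomy / rigidity margins, forward window, kill).  This file chooses them: a ONE-PARAMETER cascade
`s` (stratum) ≫ `e` (near-critical thresholds, `R = 2e/h_min`, kill level `2e`) ≫ `τ` ≫ `λ` ≫ `η₀F`, each step strict at `κ = 0` by continuity at `0` of
an explicit polynomial expression, and finally the perturbation size `κ` by continuity of the `pc*` at `κ = 0` (`continuousAt_pc*`).

* `continuousAt_pcMG`, `continuousAt_pcManti`, `continuousAt_pcMdiag`, `continuousAt_pcAdiag` (plumbing);
* **`exists_thin_small_constants`** — for every margin `m > 0`: `κ, τ, λ, η₀F, e, s` with `0 < κ < Dt_min`, `κ ≤ s ≤ m`, satisfying every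
  hypothesis of `count_pairs_thin_perturbed_exists` with `κ₀ = κ₁ = κ₂ = κ`, `η₀″ = η₁″ = e`, `η₀K = 2e`, `η₀S = η₁S = m₀ = s`, `R = 2e/h_min`.

Everything is PROVED; no definitions.  References: BGM 2006 Lemma 3.1 / App. A2–A3 [cite: BenfattoGiulianiMastropietro2006]; Mastropietro 2008 (14.67)
[cite: Mastropietro2008].
-/

noncomputable section

namespace Summit.HubbardSuperconductivity.HubbardSuperconductivity.Theorems.PerturbedFermiCurve

set_option linter.dupNamespace false -- summit = problem name (single-conjunct summit), D-0017

open Real Set Filter Topology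
open Literature.MathematicalPhysics.QuantumLattice Literature.MathematicalPhysics.QuantumLattice.BandSectorCounting

variable {a b : ℝ}

/-! ## §1 Continuity of the remaining named constants at `κ = 0` -/

/-- `κ ↦ M_Γ(κ, κ)` is continuous at `0`. [folklore] -/
theorem continuousAt_pcMG (B : BandBounds a b) : ContinuousAt (fun κ : ℝ => pcMG B κ κ) 0 := by
  have hSE := continuousAt_pcSE B; have hAE := continuousAt_pcAE B
  unfold pcMG
  exact (((continuousAt_const.mul (hSE.pow 2)).add (continuousAt_const.mul (continuousAt_id.mul (hSE.pow 2)))).add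
    (continuousAt_const.mul hAE)).add (continuousAt_id.mul hAE)

/-- `κ ↦ M_anti(κ, κ)` is continuous at `0`. [folklore] -/
theorem continuousAt_pcManti (B : BandBounds a b) : ContinuousAt (fun κ : ℝ => pcManti B κ κ) 0 := by
  have hAE := continuousAt_pcAE B
  unfold pcManti
  exact (continuousAt_const.mul hAE).add ((continuousAt_id.mul hAE).div_const 2)

/-- `κ ↦ M_diag(κ)` is continuous at `0`. [folklore] -/
theorem continuousAt_pcMdiag (B : BandBounds a b) : ContinuousAt (fun κ : ℝ => pcMdiag B κ) 0 := by
  have hSE := continuousAt_pcSE B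
  unfold pcMdiag
  exact continuousAt_const.mul ((continuousAt_const.add continuousAt_id).mul hSE)

/-- `κ ↦ A_diag(κ, κ)` is continuous at `0`. [folklore] -/
theorem continuousAt_pcAdiag (B : BandBounds a b) : ContinuousAt (fun κ : ℝ => pcAdiag B κ κ) 0 := by
  have hSE := continuousAt_pcSE B; have hAE := continuousAt_pcAE B
  unfold pcAdiag
  exact (((continuousAt_const.mul (hSE.pow 2)).add (continuousAt_const.mul hAE)).add
    (continuousAt_const.mul (continuousAt_id.mul (hSE.pow 2)))).add (continuousAt_const.mul (continuousAt_id.mul hAE))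

/-- Extraction of a small positive point from an `eventually` at `0`: some `0 < x ≤ c` satisfies the property. [folklore] -/
private theorem exists_pos_le_of_eventually {p : ℝ → Prop} {c : ℝ} (hc : 0 < c) (h : ∀ᶠ x in 𝓝 (0 : ℝ), p x) :
    ∃ x : ℝ, 0 < x ∧ x ≤ c ∧ p x := by
  obtain ⟨ε, hε, hball⟩ := Metric.eventually_nhds_iff.1 h
  refine ⟨min (ε / 2) c, lt_min (by linarith) hc, min_le_right _ _, hball ?_⟩
  rw [dist_zero_right, Real.norm_eq_abs, abs_of_pos (lt_min (by linarith) hc)]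
  exact lt_of_le_of_lt (min_le_left _ _) (by linarith)

/-! ## §2 The small constants -/

set_option maxHeartbeats 1600000 in
/-- **The small constants of the thin anchored count.**  For every margin `m > 0` there are `κ τ λ η₀F e s` (`0 < κ < Dt_min`, `κ ≤ s ≤ m`, …)
satisfying all the smallness hypotheses of `count_pairs_thin_perturbed_exists` with `κ₀ = κ₁ = κ₂ = κ`, `η₀″ = η₁″ = e`, `η₀K = 2e`,
`η₀S = η₁S = m₀ = s`, `R = 2e/h_min`. [cite: BenfattoGiulianiMastropietro2006, Lemma 3.1 / App. A2–A3] -/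
theorem exists_thin_small_constants (B : BandBounds a b) {m : ℝ} (hm : 0 < m) :
    ∃ κ τ lam f e s : ℝ, 0 < κ ∧ κ < B.Dtmin ∧ κ ≤ s ∧ 0 < s ∧ s ≤ m ∧ 0 < τ ∧ τ < π ∧ 0 < lam ∧ 0 < f ∧ 0 < e ∧
      f ≤ s ∧ e ≤ s ∧ 2 * e ≤ s ∧
      2 * (B.Cg * pcE4 B κ κ lam f) ≤ τ ∧
      pcOdd B κ κ κ (2 * lam) f τ ≤ B.hmin / 2 ∧
      κ * pcAE B κ κ ≤ B.hmin / 2 ∧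
      pcEven B κ κ κ lam f τ ≤ B.hmin / 2 ∧
      pcDiag B κ κ κ s s ≤ 2 * B.hmin ∧
      e + pcMdiag B κ * (2 * e / B.hmin) ≤ s ∧
      e + pcAdiag B κ κ * (2 * e / B.hmin) ≤ s ∧
      e ≤ 2 * B.hmin * (2 * e / B.hmin) / 4 ∧
      2 * lam + pcMG B κ κ * τ ≤ e ∧
      2 * (e / B.Dtmin + 2 * κ / B.Dtmin + B.smax * (B.Cg * pcE4 B κ κ (e / 2) e)) < B.rhomin ^ 2 ∧
      e / B.Dtmin + 2 * κ / B.Dtmin + B.smax * (B.Cg * pcE4 B κ κ (e / 2) e) < 1 / 2 ∧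
      π * (e / B.Dtmin + 2 * κ / B.Dtmin + B.smax * (B.Cg * pcE4 B κ κ (e / 2) e)) + 2 * umklappRadius b < 2 * π ∧
      pcAdiag B κ κ * (π * (π * (e / B.Dtmin + 2 * κ / B.Dtmin + B.smax * (B.Cg * pcE4 B κ κ (e / 2) e)) / (Real.sqrt 2 * B.umin))) ≤ s ∧
      pcAdiag B κ κ * (π * (π * (e / B.Dtmin + 2 * κ / B.Dtmin + B.smax * (B.Cg * pcE4 B κ κ (e / 2) e)) / (Real.sqrt 2 * B.umin))) ^ 2 ≤ s ∧
      pcEven B κ κ κ (e / 2) (2 * e) τ ≤ B.hmin / 2 ∧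
      2 * (2 * e / B.Dtmin + 2 * κ / B.Dtmin +
        B.smax * (B.Cg * pcE4 B κ κ (2 * (e / 2) + (4 + κ) * pcAE B κ κ * τ / 2) (2 * e) + τ / 2)) < B.rhomin ^ 2 ∧
      pcManti B κ κ * τ ^ 2 ≤ 2 * e / 2 ∧
      pcMG B κ κ * τ ≤ 2 * (e / 2) ∧
      3 * pcSE B κ * τ < B.rhomin ^ 2 - 2 * (e / B.Dtmin + 2 * κ / B.Dtmin + B.smax * (B.Cg * pcE4 B κ κ (e / 2) e)) := by
  have hs := B.smax_pos; have hh := B.hmin_pos; have hCg := B.Cg_pos; have hDt := B.Dtmin_pos; have hπ := Real.pi_pos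
  have hu := B.umin_pos; have hρ := B.rhomin_pos
  have hρ2 : 0 < B.rhomin ^ 2 := by positivity
  obtain ⟨-, -, -, -, hAE0, -⟩ := pc_pos B le_rfl hDt le_rfl
  obtain ⟨A₀, hA₀⟩ : ∃ A₀ : ℝ, A₀ = pcAE B 0 0 := ⟨_, rfl⟩
  rw [← hA₀] at hAE0
  have hK : umklappRadius b < π := umklappRadius_lt_pi B.hb
  have hs2 : 0 < Real.sqrt 2 := Real.sqrt_pos.2 (by norm_num)
  -- values at `κ = 0`
  have eSE : pcSE B 0 = B.smax := pcSE_zero B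
  have eMG : pcMG B 0 0 = 8 * B.smax ^ 2 + 4 * A₀ := by unfold pcMG; rw [eSE, ← hA₀]; ring
  have eManti : pcManti B 0 0 = 2 * A₀ := by unfold pcManti; rw [← hA₀]; ring
  have eMdiag : pcMdiag B 0 = 8 * B.smax := by unfold pcMdiag; rw [eSE]; ring
  have eAdiag : pcAdiag B 0 0 = 16 * B.smax ^ 2 + 8 * A₀ := by unfold pcAdiag; rw [eSE, ← hA₀]; ring
  have eE4 : ∀ L η : ℝ, pcE4 B 0 0 L η = L / 2 + 2 * B.smax * (η / B.Dtmin) := pcE4_zero B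
  -- Step A: the stratum level `s`
  set dA := (16 * B.smax ^ 2 + 8 * A₀) * (1 / B.Dtmin + B.smax * (B.Cg * (1 / 4 + 2 * B.smax * (1 / B.Dtmin)))) with hdA
  have hdA0 : 0 < dA := by rw [hdA]; positivity
  set s := min m (min (1 / 2) (B.hmin / dA)) with hsdef
  have hs0 : 0 < s := lt_min hm (lt_min (by norm_num) (by positivity))
  have hsm : s ≤ m := min_le_left _ _
  have hshalf : s ≤ 1 / 2 := (min_le_right _ _).trans (min_le_left _ _)
  have hsA : s ≤ B.hmin / dA := (min_le_right _ _).trans (min_le_right _ _)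
  have sDiag : pcDiag B 0 0 0 s s < 2 * B.hmin := by
    rw [pcDiag_zero, ← hA₀]
    have e : (16 * B.smax ^ 2 + 8 * A₀) * (s / B.Dtmin + B.smax * (B.Cg * (s / 4 + 2 * B.smax * (s / B.Dtmin)))) = s * dA := by
      rw [hdA]; ring
    rw [e]
    have : s * dA ≤ B.hmin := by rw [le_div_iff₀ hdA0] at hsA; exact hsA
    linarith
  -- Step B: the near-critical threshold `e`
  set dE := 1 / B.Dtmin + B.smax * (B.Cg * (1 / 4 + 2 * B.smax * (1 / B.Dtmin))) with hdE
  have hdE0 : 0 < dE := by rw [hdE]; positivity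
  have hE30 : ∀ e : ℝ, e / B.Dtmin + B.smax * (B.Cg * pcE4 B 0 0 (e / 2) e) = e * dE := by
    intro e; rw [eE4, hdE]; ring
  have evB : ∀ᶠ e in 𝓝 (0 : ℝ),
      e + 8 * B.smax * (2 * e / B.hmin) < s ∧
      e + (16 * B.smax ^ 2 + 8 * A₀) * (2 * e / B.hmin) < s ∧
      2 * (e * dE) < B.rhomin ^ 2 / 2 ∧
      e * dE < 1 / 2 ∧
      π * (e * dE) + 2 * umklappRadius b < 2 * π ∧
      (16 * B.smax ^ 2 + 8 * A₀) * (π * (π * (e * dE) / (Real.sqrt 2 * B.umin))) < s ∧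
      (16 * B.smax ^ 2 + 8 * A₀) * (π * (π * (e * dE) / (Real.sqrt 2 * B.umin))) ^ 2 < s ∧
      2 * A₀ * (2 * e / B.Dtmin + B.smax * (B.Cg * (e / 2 + A₀ * 0 + 2 * B.smax * (2 * e / B.Dtmin)) + 0 / 2)) < B.hmin / 4 ∧
      2 * (2 * e / B.Dtmin + B.smax * (B.Cg * ((2 * (e / 2) + (4 + 0) * A₀ * 0 / 2) / 2 + 2 * B.smax * (2 * e / B.Dtmin)) + 0 / 2)) <
        B.rhomin ^ 2 / 2 := by
    refine (ContinuousAt.eventually_lt (by fun_prop) continuousAt_const ?_).and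
      ((ContinuousAt.eventually_lt (by fun_prop) continuousAt_const ?_).and
      ((ContinuousAt.eventually_lt (by fun_prop) continuousAt_const ?_).and
      ((ContinuousAt.eventually_lt (by fun_prop) continuousAt_const ?_).and
      ((ContinuousAt.eventually_lt (by fun_prop) continuousAt_const ?_).and
      ((ContinuousAt.eventually_lt (by fun_prop) continuousAt_const ?_).and
      ((ContinuousAt.eventually_lt (by fun_prop) continuousAt_const ?_).and
      ((ContinuousAt.eventually_lt (by fun_prop) continuousAt_const ?_).and
      (ContinuousAt.eventually_lt (by fun_prop) continuousAt_const ?_))))))))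
    · simp; exact hs0
    · simp; exact hs0
    · simp; positivity
    · simp
    · simp; linarith [hK]
    · simp; exact hs0
    · simp; exact hs0
    · simp; positivity
    · simp; positivity
  obtain ⟨e, he0, hes, hB⟩ := exists_pos_le_of_eventually (show 0 < s / 4 by positivity) evB
  obtain ⟨b1, b2, b3, b4, b5, b6, b7, b8, b9⟩ := hB
  have hes' : 2 * e ≤ s := by linarith
  -- Step D: the row window `τ`
  have evD : ∀ᶠ τ in 𝓝 (0 : ℝ),
      2 * A₀ * τ ^ 2 < e ∧
      (8 * B.smax ^ 2 + 4 * A₀) * τ < e / 2 ∧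
      3 * B.smax * τ < B.rhomin ^ 2 - 2 * (e * dE) ∧
      2 * A₀ * (2 * e / B.Dtmin + B.smax * (B.Cg * (e / 2 + A₀ * τ + 2 * B.smax * (2 * e / B.Dtmin)) + τ / 2)) < B.hmin / 2 ∧
      2 * (2 * e / B.Dtmin + B.smax * (B.Cg * ((2 * (e / 2) + (4 + 0) * A₀ * τ / 2) / 2 + 2 * B.smax * (2 * e / B.Dtmin)) + τ / 2)) <
        B.rhomin ^ 2 ∧
      2 * A₀ * B.smax * τ < B.hmin / 8 ∧
      2 * A₀ * B.smax * (B.Cg * (A₀ * τ) + τ / 2) < B.hmin / 8 ∧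
      τ < π := by
    refine (ContinuousAt.eventually_lt (by fun_prop) continuousAt_const ?_).and
      ((ContinuousAt.eventually_lt (by fun_prop) continuousAt_const ?_).and
      ((ContinuousAt.eventually_lt (by fun_prop) continuousAt_const ?_).and
      ((ContinuousAt.eventually_lt (by fun_prop) continuousAt_const ?_).and
      ((ContinuousAt.eventually_lt (by fun_prop) continuousAt_const ?_).and
      ((ContinuousAt.eventually_lt (by fun_prop) continuousAt_const ?_).and
      ((ContinuousAt.eventually_lt (by fun_prop) continuousAt_const ?_).and
      (ContinuousAt.eventually_lt (by fun_prop) continuousAt_const ?_)))))))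
    · simp; exact he0
    · simp; positivity
    · simp; linarith [b3, hρ2]
    · simp only [mul_zero, add_zero, zero_div]; simp only [mul_zero, add_zero, zero_div] at b8; linarith [b8]
    · simp only [mul_zero, add_zero, zero_div]; simp only [mul_zero, add_zero, zero_div] at b9; linarith [b9, hρ2]
    · simp; positivity
    · simp; positivity
    · exact hπ
  obtain ⟨τ, hτ0, -, hD⟩ := exists_pos_le_of_eventually one_pos evD
  obtain ⟨d1, d2, d3, d4, d5, d6, d7, d8⟩ := hD
  -- Step E: the partial threshold `λ`
  have evE : ∀ᶠ lam in 𝓝 (0 : ℝ),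
      2 * lam + (8 * B.smax ^ 2 + 4 * A₀) * τ < e ∧
      B.Cg * lam < τ / 2 ∧
      2 * A₀ * (B.smax * (B.Cg * lam + τ)) < B.hmin / 4 ∧
      2 * A₀ * (B.smax * (B.Cg * (lam + A₀ * τ) + τ / 2)) < B.hmin / 4 := by
    refine (ContinuousAt.eventually_lt (by fun_prop) continuousAt_const ?_).and
      ((ContinuousAt.eventually_lt (by fun_prop) continuousAt_const ?_).and
      ((ContinuousAt.eventually_lt (by fun_prop) continuousAt_const ?_).and
      (ContinuousAt.eventually_lt (by fun_prop) continuousAt_const ?_)))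
    · simp; linarith
    · simp; positivity
    · simp; nlinarith [d6]
    · simp; nlinarith [d7]
  obtain ⟨lam, hlam0, -, hE⟩ := exists_pos_le_of_eventually one_pos evE
  obtain ⟨c1, c2, c3, c4⟩ := hE
  -- Step F: the fat level `η₀F`
  have evF : ∀ᶠ f in 𝓝 (0 : ℝ),
      2 * (B.Cg * (lam / 2 + 2 * B.smax * (f / B.Dtmin))) < τ ∧
      2 * A₀ * (f / B.Dtmin + B.smax * (B.Cg * (2 * lam / 2 + 2 * B.smax * (f / B.Dtmin)) + τ)) < B.hmin / 2 ∧
      2 * A₀ * (f / B.Dtmin + B.smax * (B.Cg * (lam + A₀ * τ + 2 * B.smax * (f / B.Dtmin)) + τ / 2)) < B.hmin / 2 := by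
    refine (ContinuousAt.eventually_lt (by fun_prop) continuousAt_const ?_).and
      ((ContinuousAt.eventually_lt (by fun_prop) continuousAt_const ?_).and
      (ContinuousAt.eventually_lt (by fun_prop) continuousAt_const ?_))
    · simp; linarith
    · simp; linarith
    · simp; linarith
  obtain ⟨f, hf0, hfe, hF⟩ := exists_pos_le_of_eventually he0 evF
  obtain ⟨f1, f2, f3⟩ := hF
  -- the conditions hold STRICTLY at `κ = 0`
  have s1 : 2 * (B.Cg * pcE4 B 0 0 lam f) < τ := by rw [eE4]; exact f1
  have s2 : pcOdd B 0 0 0 (2 * lam) f τ < B.hmin / 2 := by rw [pcOdd_zero, ← hA₀]; exact f2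
  have s3 : (0 : ℝ) * pcAE B 0 0 < B.hmin / 2 := by rw [zero_mul]; positivity
  have s4 : pcEven B 0 0 0 lam f τ < B.hmin / 2 := by rw [pcEven_zero, ← hA₀]; exact f3
  have s6 : e + pcMdiag B 0 * (2 * e / B.hmin) < s := by rw [eMdiag]; exact b1
  have s7 : e + pcAdiag B 0 0 * (2 * e / B.hmin) < s := by rw [eAdiag]; exact b2
  have s9 : 2 * lam + pcMG B 0 0 * τ < e := by rw [eMG]; exact c1
  have s10 : 2 * (e / B.Dtmin + 2 * 0 / B.Dtmin + B.smax * (B.Cg * pcE4 B 0 0 (e / 2) e)) < B.rhomin ^ 2 := by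
    rw [show e / B.Dtmin + 2 * 0 / B.Dtmin + B.smax * (B.Cg * pcE4 B 0 0 (e / 2) e) = e * dE by rw [← hE30 e]; ring]; linarith [b3, hρ2]
  have s11 : e / B.Dtmin + 2 * 0 / B.Dtmin + B.smax * (B.Cg * pcE4 B 0 0 (e / 2) e) < 1 / 2 := by
    rw [show e / B.Dtmin + 2 * 0 / B.Dtmin + B.smax * (B.Cg * pcE4 B 0 0 (e / 2) e) = e * dE by rw [← hE30 e]; ring]; exact b4
  have s12 : π * (e / B.Dtmin + 2 * 0 / B.Dtmin + B.smax * (B.Cg * pcE4 B 0 0 (e / 2) e)) + 2 * umklappRadius b < 2 * π := by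
    rw [show e / B.Dtmin + 2 * 0 / B.Dtmin + B.smax * (B.Cg * pcE4 B 0 0 (e / 2) e) = e * dE by rw [← hE30 e]; ring]; exact b5
  have s13 : pcAdiag B 0 0 * (π * (π * (e / B.Dtmin + 2 * 0 / B.Dtmin + B.smax * (B.Cg * pcE4 B 0 0 (e / 2) e)) / (Real.sqrt 2 * B.umin))) < s := by
    rw [show e / B.Dtmin + 2 * 0 / B.Dtmin + B.smax * (B.Cg * pcE4 B 0 0 (e / 2) e) = e * dE by rw [← hE30 e]; ring, eAdiag]; exact b6
  have s14 : pcAdiag B 0 0 * (π * (π * (e / B.Dtmin + 2 * 0 / B.Dtmin + B.smax * (B.Cg * pcE4 B 0 0 (e / 2) e)) / (Real.sqrt 2 * B.umin))) ^ 2 < s := by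
    rw [show e / B.Dtmin + 2 * 0 / B.Dtmin + B.smax * (B.Cg * pcE4 B 0 0 (e / 2) e) = e * dE by rw [← hE30 e]; ring, eAdiag]; exact b7
  have s16 : pcEven B 0 0 0 (e / 2) (2 * e) τ < B.hmin / 2 := by rw [pcEven_zero, ← hA₀]; exact d4
  have s17 : 2 * (2 * e / B.Dtmin + 2 * 0 / B.Dtmin +
      B.smax * (B.Cg * pcE4 B 0 0 (2 * (e / 2) + (4 + 0) * pcAE B 0 0 * τ / 2) (2 * e) + τ / 2)) < B.rhomin ^ 2 := by
    rw [eE4, ← hA₀]; simp only [mul_zero, zero_div, add_zero] at d5 ⊢; exact d5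
  have s18 : pcManti B 0 0 * τ ^ 2 < 2 * e / 2 := by rw [eManti]; linarith
  have s19 : pcMG B 0 0 * τ < 2 * (e / 2) := by rw [eMG]; linarith
  have s20 : 3 * pcSE B 0 * τ < B.rhomin ^ 2 - 2 * (e / B.Dtmin + 2 * 0 / B.Dtmin + B.smax * (B.Cg * pcE4 B 0 0 (e / 2) e)) := by
    rw [show e / B.Dtmin + 2 * 0 / B.Dtmin + B.smax * (B.Cg * pcE4 B 0 0 (e / 2) e) = e * dE by rw [← hE30 e]; ring, eSE]; exact d3
  -- continuity in `κ` at `0`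
  have hSE := continuousAt_pcSE B
  have hAE := continuousAt_pcAE B
  have hMG := continuousAt_pcMG B
  have hMa := continuousAt_pcManti B
  have hMd := continuousAt_pcMdiag B
  have hAd := continuousAt_pcAdiag B
  have hE3 : ContinuousAt (fun κ : ℝ => e / B.Dtmin + 2 * κ / B.Dtmin + B.smax * (B.Cg * pcE4 B κ κ (e / 2) e)) 0 :=
    (continuousAt_const.add ((continuousAt_const.mul continuousAt_id).div_const _)).add
      (continuousAt_const.mul (continuousAt_const.mul (continuousAt_pcE4 B (e / 2) e)))
  have ev1 := (continuousAt_const.mul (continuousAt_const.mul (continuousAt_pcE4 B lam f))).eventually_lt continuousAt_const s1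
  have ev2 := (continuousAt_pcOdd B (2 * lam) f τ).eventually_lt continuousAt_const s2
  have ev3 := (continuousAt_mul_pcAE B).eventually_lt continuousAt_const s3
  have ev4 := (continuousAt_pcEven B lam f τ).eventually_lt continuousAt_const s4
  have ev5 := (continuousAt_pcDiag B s s).eventually_lt continuousAt_const sDiag
  have ev6 := (continuousAt_const.add (hMd.mul continuousAt_const)).eventually_lt continuousAt_const s6
  have ev7 := (continuousAt_const.add (hAd.mul continuousAt_const)).eventually_lt continuousAt_const s7
  have ev9 := (continuousAt_const.add (hMG.mul continuousAt_const)).eventually_lt continuousAt_const s9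
  have ev10 := (continuousAt_const.mul hE3).eventually_lt continuousAt_const s10
  have ev11 := hE3.eventually_lt continuousAt_const s11
  have ev12 := ((continuousAt_const.mul hE3).add continuousAt_const).eventually_lt continuousAt_const s12
  have ev13 := (hAd.mul (continuousAt_const.mul ((continuousAt_const.mul hE3).div_const _))).eventually_lt continuousAt_const s13
  have ev14 := (hAd.mul ((continuousAt_const.mul ((continuousAt_const.mul hE3).div_const _)).pow 2)).eventually_lt continuousAt_const s14
  have ev16 := (continuousAt_pcEven B (e / 2) (2 * e) τ).eventually_lt continuousAt_const s16
  have hL : ContinuousAt (fun κ : ℝ => 2 * (e / 2) + (4 + κ) * pcAE B κ κ * τ / 2) 0 :=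
    continuousAt_const.add ((((continuousAt_const.add continuousAt_id).mul hAE).mul continuousAt_const).div_const 2)
  have ev17 := (continuousAt_const.mul ((continuousAt_const.add ((continuousAt_const.mul continuousAt_id).div_const _)).add
    (continuousAt_const.mul ((continuousAt_const.mul (continuousAt_pcE4_comp B hL (2 * e))).add continuousAt_const)))).eventually_lt
    continuousAt_const s17
  have ev18 := (hMa.mul continuousAt_const).eventually_lt continuousAt_const s18
  have ev19 := (hMG.mul continuousAt_const).eventually_lt continuousAt_const s19
  have ev20 := ((continuousAt_const.mul hSE).mul continuousAt_const).eventually_lt (continuousAt_const.sub (continuousAt_const.mul hE3)) s20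
  obtain ⟨κ, hκ0, hκf, hG⟩ := exists_pos_le_of_eventually (show 0 < min f (B.Dtmin / 2) from lt_min hf0 (by positivity))
    (ev1.and (ev2.and (ev3.and (ev4.and (ev5.and (ev6.and (ev7.and (ev9.and (ev10.and (ev11.and (ev12.and (ev13.and (ev14.and
      (ev16.and (ev17.and (ev18.and (ev19.and ev20)))))))))))))))))
  obtain ⟨g1, g2, g3, g4, g5, g6, g7, g9, g10, g11, g12, g13, g14, g16, g17, g18, g19, g20⟩ := hG
  have hκD : κ < B.Dtmin := by have := hκf.trans (min_le_right _ _); linarith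
  have hκs : κ ≤ s := (hκf.trans (min_le_left _ _)).trans (hfe.trans (by linarith))
  refine ⟨κ, τ, lam, f, e, s, hκ0, hκD, hκs, hs0, hsm, hτ0, d8, hlam0, hf0, he0, hfe.trans (by linarith), by linarith, hes',
    g1.le, g2.le, g3.le, g4.le, g5.le, g6.le, g7.le, ?_, g9.le, g10, g11, g12, g13.le, g14.le, g16.le, g17, g18.le, g19.le, g20⟩
  -- the `κ`-free identity `e ≤ 2h(2e/h)/4 = e`
  have : 2 * B.hmin * (2 * e / B.hmin) / 4 = e := by field_simp; ring
  rw [this]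

end Summit.HubbardSuperconductivity.HubbardSuperconductivity.Theorems.PerturbedFermiCurve

end
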